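import Summits.BirchSwinnertonDyer.BirchSwinnertonDyer.Theorems.SchneiderFreeAdditiveX3GaloisHeckeValues
import Literature.NumberTheory.EllipticCurves.Gross2004.RationalCharacterLSeries
import Literature.NumberTheory.QuadraticFields.JacobiCharacter
import Mathlib.NumberTheory.GaussSum
import HarnessLib

/-!
# Route `SchneiderFreeAdditiveX3` (K1 door), cruxes `PotMultBranchIMC` / `GordTwoBranchIMC`
# (items stmt-BirchSwinnertonDyer-19176 / 19177): the GENUS CHARACTER in GALOIS currency — FILE 2 of
# W2: a rational character for `p*` IS `(·/p) ∘ χ_p`; `heckeValueAt χ_gal v = (N v / p)` off `p`, `0` above `p`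

Cell `bsd-schneider-ideate`, seat `bsd-schneider-door-c4` (prover, generation 8). HONEST FRAMING:
theorems only (no definition, no named fact, nothing asserted about BSD; both cruxes stay OPEN).
Continuation of `…GaloisHeckeValues.lean` (§1–§2: `heckeValueAt χ v = χ(Frob_v)` / `0`; Dirichlet
characters through the cyclotomic character). Here:

* §3 `eq_dirichletGaloisCharacter_jacobiChar_of_isRationalCharacterFor`: a character `χ_gal` of `Γ_K`
  which is RATIONAL for `p*` in Gross's sense (`χ_gal(γ) = +1` iff `γ` fixes `√p*`; on the door this is
  the genus character `ε` of conductor `p`, `isRationalCharacterFor_of_genusDatum`) IS `(·/p) ∘ χ_p`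
  (`dirichletGaloisCharacter K (jacobiChar p)`) — via the quadratic Gauss sum `g ∈ K̄`, `g² = p*`,
  `γ g = (χ_p(γ)/p) g` (`exists_gaussSum_pStar`; Mathlib `gaussSum_sq`, `gaussSum_mulShift`).
* §4 `heckeValueAt_genus_of_not_mem` / `heckeValueAt_genus_of_mem`: hence for the genus character
  `heckeValueAt χ_gal v = (N v / p)` at `v ∤ p` and `= 0` at `v ∣ p` (given one prime of `K` over `p`
  with `e = 1`, e.g. `p` split in an imaginary quadratic `K`) — EXACTLY the Hecke-currency values
  `θ(ℓ)^{f_v}` of `ψ_θ ∘ N_{K/ℚ}`, `θ = (·/p)`, in bsd-addord's PROVED Artin formalism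
  (`rankinSelbergEulerProductHecke_baseChangeDirichlet_eq_holds`), and the input of the companion file
  `…ArtinLinkGenus.lean` (want W2 of FINDING-door-c2-g8: the Euler-product identity
  `L(f_V ⊗ K, χ_gal, s) = L(W_K, s)` and the derivative identity `hArtin`).

References: Gross, MSRI Publ. 49 (2004) §2–§3 (rational / genus characters); Ireland–Rosen, *A
Classical Introduction to Modern Number Theory*, Prop. 6.3.2 (Gauss sum); Nekovář, Math. Ann. 302
(1995) (0.5), (3.2.1); Neukirch, *Algebraic Number Theory* I §9 (9.6).
-/

noncomputable section

open scoped NumberField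
open Field IsDedekindDomain NumberField Polynomial
open Literature.NumberTheory.GaloisRepresentations

-- D-0017 layout: summit = sub-problem, so `Summit.BirchSwinnertonDyer.BirchSwinnertonDyer.…` is the
-- mandated namespace (same option as the route's sockets files).
set_option linter.dupNamespace false
set_option autoImplicit false

namespace Summit.BirchSwinnertonDyer.BirchSwinnertonDyer.Theorems.SchneiderFree

open Literature.NumberTheory.EllipticCurves

universe u

variable {K : Type u} [Field K] [NumberField K]

/-! ## §3 The genus character `χ_{p*}|_{Γ_K}`: a rational character for `p*` IS `(·/p) ∘ χ_p` -/

section Genus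

open scoped NumberTheorySymbols
open Literature.NumberTheory.QuadraticFields

/-- **Gauss's sum in `K̄`: `g = Σ_a (a/p) ζ^a` has `g² = p*` and `γ g = (χ_p(γ)/p) g`.** For an odd
prime `p` and a primitive `p`-th root of unity `ζ ∈ K̄`, the quadratic Gauss sum satisfies
`g² = (−1/p) p = p*` (Mathlib `gaussSum_sq`) and every `γ ∈ Γ_K` acts on it through the Legendre
symbol of its cyclotomic character (`γ ζ = ζ^{χ_p(γ)}`, `gaussSum_mulShift`).
[cite: IrelandRosen1990, Ch. 6 §3 Prop. 6.3.2] -/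
theorem exists_gaussSum_pStar {p : ℕ} [Fact p.Prime] (hp2 : p ≠ 2) :
    ∃ g : AlgebraicClosure K, g ^ 2 = (((-1 : ℤ) ^ (p / 2) * p : ℤ) : AlgebraicClosure K) ∧ g ≠ 0 ∧
      ∀ γ : absoluteGaloisGroup K,
        γ • g = ((legendreSym p ((modNCyclotomicCharacter K p γ : ZMod p)).val : ℤ) :
          AlgebraicClosure K) * g := by
  have hp : p.Prime := Fact.out
  haveI : NeZero p := ⟨hp.ne_zero⟩
  obtain ⟨ζ, hζ⟩ := HasEnoughRootsOfUnity.exists_primitiveRoot (AlgebraicClosure K) p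
  set ψ : AddChar (ZMod p) (AlgebraicClosure K) := AddChar.zmodChar p hζ.pow_eq_one with hψdef
  have hψ : ψ.IsPrimitive := AddChar.zmodChar_primitive_of_primitive_root p hζ
  set χ : MulChar (ZMod p) (AlgebraicClosure K) :=
    (quadraticChar (ZMod p)).ringHomComp (Int.castRingHom (AlgebraicClosure K)) with hχdef
  have hchar : ringChar (ZMod p) ≠ 2 := by rw [ZMod.ringChar_zmod_n]; exact hp2
  have hχ1 : χ ≠ 1 :=
    (MulChar.ringHomComp_ne_one_iff (RingHom.injective_int _)).mpr (quadraticChar_ne_one hchar)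
  have hχ2 : χ.IsQuadratic := (quadraticChar_isQuadratic (ZMod p)).comp _
  have hsq : gaussSum χ ψ ^ 2 = (((-1 : ℤ) ^ (p / 2) * p : ℤ) : AlgebraicClosure K) := by
    rw [gaussSum_sq hχ1 hχ2 hψ, ZMod.card p]
    have hodd : p % 2 = 1 := Nat.odd_iff.mp (hp.odd_of_ne_two hp2)
    have hneg : χ (-1) = ((-1 : ℤ) ^ (p / 2) : ℤ) := by
      rw [hχdef, MulChar.ringHomComp_apply, quadraticChar_neg_one hchar, ZMod.card p,
        ZMod.χ₄_eq_neg_one_pow hodd]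
      simp
    rw [hneg]
    push_cast
    ring
  have hpne : (((-1 : ℤ) ^ (p / 2) * p : ℤ) : AlgebraicClosure K) ≠ 0 := by
    rw [Int.cast_ne_zero]
    exact mul_ne_zero (pow_ne_zero _ (by norm_num)) (by exact_mod_cast hp.ne_zero)
  have hne : gaussSum χ ψ ≠ 0 := by
    intro h0
    rw [h0, zero_pow two_ne_zero] at hsq
    exact hpne hsq.symm
  refine ⟨gaussSum χ ψ, hsq, hne, fun γ ↦ ?_⟩
  -- the cyclotomic character: `γ ζ = ζ^c`
  set c : ZMod p := (modNCyclotomicCharacter K p γ : ZMod p) with hcdef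
  have hγζ : γ • ζ = ζ ^ c.val := modNCyclotomicCharacter_spec K p γ ζ hζ.pow_eq_one
  have hpowmod : ∀ m : ℕ, ζ ^ (m % p) = ζ ^ m := fun m ↦ by
    conv_rhs => rw [← Nat.mod_add_div m p, pow_add, pow_mul, hζ.pow_eq_one, one_pow, mul_one]
  -- `γ` fixes the (integer) values of `χ` and sends `ψ a = ζ^a` to `ψ (c a)`
  have hχfix : ∀ a : ZMod p, γ • χ a = χ a := fun a ↦ by
    rw [hχdef, MulChar.ringHomComp_apply, absoluteGaloisGroup.smul_def]
    exact map_intCast _ _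
  have hψmap : ∀ a : ZMod p, γ • ψ a = ψ (c * a) := fun a ↦ by
    rw [hψdef, AddChar.zmodChar_apply, AddChar.zmodChar_apply, smul_pow', hγζ, ← pow_mul,
      ZMod.val_mul, hpowmod]
  have hγg : γ • gaussSum χ ψ = gaussSum χ (ψ.mulShift c) := by
    rw [gaussSum, gaussSum, Finset.smul_sum]
    refine Finset.sum_congr rfl fun a _ ↦ ?_
    rw [smul_mul', hχfix, hψmap, AddChar.mulShift_apply]
  -- `gaussSum χ (ψ.mulShift c) = χ c · gaussSum χ ψ` (`χ c = ±1`)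
  have hcu : IsUnit c := (modNCyclotomicCharacter K p γ).isUnit
  have hc0 : c ≠ 0 := hcu.ne_zero
  have hχc : χ c * χ c = 1 := by
    rw [hχdef, MulChar.ringHomComp_apply, ← map_mul, ← sq, quadraticChar_sq_one hc0, map_one]
  have hshift := gaussSum_mulShift χ ψ hcu.unit
  rw [IsUnit.unit_spec] at hshift
  have hval : γ • gaussSum χ ψ = χ c * gaussSum χ ψ := by
    rw [hγg]
    calc gaussSum χ (ψ.mulShift c) = (χ c * χ c) * gaussSum χ (ψ.mulShift c) := by
            rw [hχc, one_mul]
      _ = χ c * (χ c * gaussSum χ (ψ.mulShift c)) := by ring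
      _ = χ c * gaussSum χ ψ := by rw [hshift]
  rw [hval, hχdef, MulChar.ringHomComp_apply, legendreSym, Int.cast_natCast, ZMod.natCast_zmod_val]
  simp only [eq_intCast]

/-- **A rational character for `p*` is the Legendre character of the cyclotomic character.** Let
`p` be an odd prime and `χ_gal : Γ_K → ℂˣ` a character with `χ_gal(γ) = +1` iff `γ` fixes a square
root `r` of `p* = (−1)^{(p−1)/2} p` in `K̄` (`Gross2004.IsRationalCharacterFor χ_gal p*` — on the door
the genus character `ε` of conductor `p`, via `isRationalCharacterFor_of_genusDatum`). Then
`χ_gal = (·/p) ∘ χ_p` (`dirichletGaloisCharacter K (jacobiChar p)`): `r = ±g` for the Gauss sum `g`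
and `γ g = (χ_p(γ)/p) g` (`exists_gaussSum_pStar`). This is the Galois form of
"`χ = χ_{p*} ∘ N_{K/ℚ}`" (Gross 2004 §3: the rational character of `d₁ = p*`).
[cite: Gross2004, §2 p. 40 (rational characters)] [cite: IrelandRosen1990, Ch. 6 §3 Prop. 6.3.2] -/
theorem eq_dirichletGaloisCharacter_jacobiChar_of_isRationalCharacterFor {p : ℕ} [Fact p.Prime]
    (hp2 : p ≠ 2) (χgal : absoluteGaloisGroup K →ₜ* ℂˣ)
    (hrat : Gross2004.IsRationalCharacterFor χgal ((-1 : ℤ) ^ (p / 2) * p)) :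
    χgal = dirichletGaloisCharacter K (jacobiChar p) := by
  have hp : p.Prime := Fact.out
  haveI : NeZero p := ⟨hp.ne_zero⟩
  obtain ⟨r, hr2, hχ⟩ := hrat
  obtain ⟨g, hg2, hg0, hγ⟩ := exists_gaussSum_pStar (K := K) hp2
  -- `r = ± g`
  have hrg : r = g ∨ r = -g := by
    apply sq_eq_sq_iff_eq_or_eq_neg.mp
    rw [hr2, hg2]
  have h2 : (2 : AlgebraicClosure K) ≠ 0 := two_ne_zero
  have hgneg : g ≠ -g := fun h ↦ by
    apply hg0
    have : (2 : AlgebraicClosure K) * g = 0 := by linear_combination h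
    simpa [h2] using this
  ext γ
  -- the Legendre symbol of the cyclotomic character
  set c : ZMod p := (modNCyclotomicCharacter K p γ : ZMod p) with hcdef
  have hc0 : c ≠ 0 := (modNCyclotomicCharacter K p γ).isUnit.ne_zero
  have hfix : γ • r = r ↔ γ • g = g := by
    rcases hrg with rfl | rfl
    · exact Iff.rfl
    · rw [smul_neg, neg_inj]
  rw [hχ γ, coe_dirichletGaloisCharacter_apply, jacobiChar_apply, ← hcdef,
    ← jacobiSym.legendreSym.to_jacobiSym]
  -- `legendreSym p c.val = ±1`
  have hleg : legendreSym p (c.val : ℤ) = quadraticChar (ZMod p) c := by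
    rw [legendreSym, Int.cast_natCast, ZMod.natCast_zmod_val]
  rcases quadraticChar_dichotomy hc0 with hq | hq
  · have hγg : γ • g = g := by rw [hγ γ, hleg, hq]; simp
    rw [if_pos (hfix.mpr hγg), hleg, hq]; simp
  · have hγg : γ • g ≠ g := by
      rw [hγ γ, hleg, hq]
      simpa using fun h ↦ hgneg h.symm
    rw [if_neg (fun h ↦ hγg (hfix.mp h)), hleg, hq]; simp

end Genus

/-! ## §4 The genus character's values "extended by zero", place by place -/

section GenusValues

open scoped NumberTheorySymbols
open Literature.NumberTheory.QuadraticFields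

/-- **Off `p`: `heckeValueAt χ_gal v = (N v / p)`** for a rational character `χ_gal` for `p*` (`p`
odd) and a finite place `v ∌ p` of `K`: `χ_gal = (·/p) ∘ χ_p` is unramified at `v` and an arithmetic
Frobenius has cyclotomic character `N v`. With `N v = ℓ^{f_v}` this is `(ℓ/p)^{f_v}`, the
Hecke-currency value of `χ_{p*} ∘ N_{K/ℚ}` at `v`. [cite: Nekovar1995, (0.5) and (3.2.1)]
[cite: Gross2004, §3 p. 40] -/
theorem heckeValueAt_genus_of_not_mem {p : ℕ} [Fact p.Prime] (hp2 : p ≠ 2)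
    (χgal : absoluteGaloisGroup K →ₜ* ℂˣ)
    (hrat : Gross2004.IsRationalCharacterFor χgal ((-1 : ℤ) ^ (p / 2) * p))
    {v : HeightOneSpectrum (𝓞 K)} (hv : ((p : ℕ) : 𝓞 K) ∉ v.asIdeal) :
    haveI : NeZero p := ⟨(Fact.out : p.Prime).ne_zero⟩
    heckeValueAt χgal v = jacobiChar p (v.residueCard : ZMod p) := by
  haveI : NeZero p := ⟨(Fact.out : p.Prime).ne_zero⟩
  rw [eq_dirichletGaloisCharacter_jacobiChar_of_isRationalCharacterFor hp2 χgal hrat]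
  exact heckeValueAt_dirichletGaloisCharacter_of_not_mem (jacobiChar p) hv

/-- The same value as a Jacobi symbol: `heckeValueAt χ_gal v = J(N v | p)`. [cite: Gross2004, §3 p. 40] -/
theorem heckeValueAt_genus_of_not_mem' {p : ℕ} [Fact p.Prime] (hp2 : p ≠ 2)
    (χgal : absoluteGaloisGroup K →ₜ* ℂˣ)
    (hrat : Gross2004.IsRationalCharacterFor χgal ((-1 : ℤ) ^ (p / 2) * p))
    {v : HeightOneSpectrum (𝓞 K)} (hv : ((p : ℕ) : 𝓞 K) ∉ v.asIdeal) :
    heckeValueAt χgal v = (J((v.residueCard : ℤ) | p) : ℂ) := by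
  haveI : NeZero p := ⟨(Fact.out : p.Prime).ne_zero⟩
  rw [heckeValueAt_genus_of_not_mem hp2 χgal hrat hv, jacobiChar_natCast]

/-- Off `p`, the rational character for `p*` is UNRAMIFIED. [cite: Gross2004, §3 p. 40] -/
theorem isUnramifiedAt_genus_of_not_mem {p : ℕ} [Fact p.Prime] (hp2 : p ≠ 2)
    (χgal : absoluteGaloisGroup K →ₜ* ℂˣ)
    (hrat : Gross2004.IsRationalCharacterFor χgal ((-1 : ℤ) ^ (p / 2) * p))
    {v : HeightOneSpectrum (𝓞 K)} (hv : ((p : ℕ) : 𝓞 K) ∉ v.asIdeal) :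
    GaloisRep.IsUnramifiedAt v (FramedArtinRep.toArtinRep (FramedRep.ofCharacter χgal)) := by
  haveI : NeZero p := ⟨(Fact.out : p.Prime).ne_zero⟩
  rw [eq_dirichletGaloisCharacter_jacobiChar_of_isRationalCharacterFor hp2 χgal hrat]
  exact isUnramifiedAt_dirichletGaloisCharacter (jacobiChar p) hv

/-- **Above `p`: `heckeValueAt χ_gal w = 0`** for a rational character `χ_gal` for `p*` (`p` odd),
`K/ℚ` Galois with a prime `𝔭 ∋ p` of ramification index `1` (e.g. `p` split in an imaginary
quadratic `K`), and any place `w ∋ p`: `χ_gal = (·/p) ∘ χ_p` is ramified above `p` (the Legendre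
character is non-trivial, `jacobiChar_ne_one`). [cite: Gross2004, §3 p. 40]
[cite: NeukirchANT1999, Ch. I §9 (9.6)] -/
theorem heckeValueAt_genus_of_mem [IsGalois ℚ K] {p : ℕ} [Fact p.Prime] (hp2 : p ≠ 2)
    (χgal : absoluteGaloisGroup K →ₜ* ℂˣ)
    (hrat : Gross2004.IsRationalCharacterFor χgal ((-1 : ℤ) ^ (p / 2) * p))
    (hunr : ∃ 𝔭 : HeightOneSpectrum (𝓞 K), ((p : ℕ) : 𝓞 K) ∈ 𝔭.asIdeal ∧
      𝔭.asIdeal.ramificationIdx (𝓞 ℚ) = 1)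
    {w : HeightOneSpectrum (𝓞 K)} (hw : ((p : ℕ) : 𝓞 K) ∈ w.asIdeal) :
    heckeValueAt χgal w = 0 := by
  have hp : p.Prime := Fact.out
  haveI : NeZero p := ⟨hp.ne_zero⟩
  rw [eq_dirichletGaloisCharacter_jacobiChar_of_isRationalCharacterFor hp2 χgal hrat]
  obtain ⟨a, ha⟩ := (MulChar.ne_one_iff).mp
    (jacobiChar_ne_one (hp.odd_of_ne_two hp2) hp.squarefree hp.one_lt.ne')
  exact heckeValueAt_dirichletGaloisCharacter_of_mem (jacobiChar p) ha hunr hw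

/-- Above `p`, the rational character for `p*` is RAMIFIED (same hypotheses). [cite: Gross2004, §3 p. 40] -/
theorem not_isUnramifiedAt_genus_of_mem [IsGalois ℚ K] {p : ℕ} [Fact p.Prime] (hp2 : p ≠ 2)
    (χgal : absoluteGaloisGroup K →ₜ* ℂˣ)
    (hrat : Gross2004.IsRationalCharacterFor χgal ((-1 : ℤ) ^ (p / 2) * p))
    (hunr : ∃ 𝔭 : HeightOneSpectrum (𝓞 K), ((p : ℕ) : 𝓞 K) ∈ 𝔭.asIdeal ∧
      𝔭.asIdeal.ramificationIdx (𝓞 ℚ) = 1)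
    {w : HeightOneSpectrum (𝓞 K)} (hw : ((p : ℕ) : 𝓞 K) ∈ w.asIdeal) :
    ¬ GaloisRep.IsUnramifiedAt w (FramedArtinRep.toArtinRep (FramedRep.ofCharacter χgal)) := by
  have hp : p.Prime := Fact.out
  haveI : NeZero p := ⟨hp.ne_zero⟩
  rw [eq_dirichletGaloisCharacter_jacobiChar_of_isRationalCharacterFor hp2 χgal hrat]
  obtain ⟨a, ha⟩ := (MulChar.ne_one_iff).mp
    (jacobiChar_ne_one (hp.odd_of_ne_two hp2) hp.squarefree hp.one_lt.ne')
  exact not_isUnramifiedAt_dirichletGaloisCharacter_of_mem (jacobiChar p) ha hunr hw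

end GenusValues

end Summit.BirchSwinnertonDyer.BirchSwinnertonDyer.Theorems.SchneiderFree

end
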